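import Mathlib
import Summits.KontsevichZagierPeriods.KontsevichZagierPeriods.Theorems.TorsionLogsNeronTorsionSectorStubRealDictionary
import Summits.KontsevichZagierPeriods.KontsevichZagierPeriods.Theorems.TorsionLogsNeronTorsionSectorStubGridDataAux
import Summits.KontsevichZagierPeriods.KontsevichZagierPeriods.Theorems.TorsionLogsNeronTorsionSectorStubGridDataAux2
import Summits.KontsevichZagierPeriods.KontsevichZagierPeriods.Theorems.TorsionLogsNeronTorsionSectorStubGridDataAux3
import Summits.KontsevichZagierPeriods.KontsevichZagierPeriods.Theorems.TorsionLogsNeronTorsionSectorStubGridDataAux4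
import HarnessLib

/-!
# Stub `stub_gridData` — crux `TorsionLogs.NeronTorsionSector`, line `registered` (block U6):
# the real Weierstrass dictionary specialised to the torsion grid

From the crux data — the real curve `y² = f(x) = 4x³ − g₂x − g₃` (`g₂³ ≠ 27g₃²`), its largest
root `e₁ > 0` (`f > 0` beyond), a point `x_P > e₁` with `N∫_{x_P}^∞ dx/√f = a·2∫_{e₁}^∞ dx/√f`
(`0 < 2a < N`), and the algebraicity of `g₂, g₃, e₁, x_P` — we produce the torsion grid used by
the translation chain of the crux: with `ω, X = ℘|ℝ, Y = ℘′|ℝ` from the landed dictionary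
`stub_realDictionary`, the parameter of `P` is `u_P = aω/N = a′ω/N′` (`a/N` in lowest terms),
the grid is `n := 8N′`, `m := 4N′`, `δ := ω/n`, `aa := 8a′` (`u_P = aa·δ`), `x k := X(kδ)`,
`y k := Y(kδ)`. The conjuncts: `12 ≤ n = 2m`, `1 ≤ aa < m`, `2N(m − aa) = n(N − 2a)`;
`x m = e₁`, `y m = 0`, `x aa = x_P`; algebraicity of all grid points (Bezout + closure of
algebraic points under the chord law + three halvings through the duplication quartic, then the
chord recursion from `P₁ = (x 1, y 1)`); on-curve, signs, reflection, strict decrease; the chord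
law in regular form; integrability of `1/√f` on `(e₁, ∞)` (its integral is `ω/2 > 0`); and the
interval behaviour of the lower/upper-branch translations `τ = X(· + δ) ∘ X⁻¹`,
`τ⁺ = X(· − δ) ∘ X⁻¹` (files `…StubGridDataAux`, `…Aux2`, `…Aux3`, `…Aux4`).

References: D. F. Lawden, *Elliptic Functions and Applications* (1989), §6.7–6.8, §6.11–6.12;
J. H. Silverman, *The Arithmetic of Elliptic Curves* (2009), III.2.3;
M. Kontsevich, D. Zagier, *Periods* (2001), §1.2.
-/

noncomputable section

-- `Summit.KontsevichZagierPeriods.KontsevichZagierPeriods.…` is the tree's mandated layout (single-conjunct summit).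
set_option linter.dupNamespace false

open Set MeasureTheory

namespace Summit.KontsevichZagierPeriods.KontsevichZagierPeriods.Cruxes.NeronTorsionSector.Translation

/-- **STUB U6 (`stub_gridData`) — the dictionary specialised to the torsion grid.** From the crux
data (curve, largest root `e₁ > 0`, `x_P` with `N∫_{x_P}^∞ dx/√f = a·2∫_{e₁}^∞ dx/√f`,
`0 < 2a < N`) and the algebraicity of `g₂, g₃, e₁, x_P`, using `stub_realDictionary`: an even grid
size `n = 2m ≥ 12` with `u_P = aa·δ` (`2N(m − aa) = n(N − 2a)`), grid points `x k = X(kδ)`,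
`y k = Y(kδ)` (`1 ≤ k ≤ n−1`) that are algebraic (closure of algebraic points under the
chord/duplication formulas of the dictionary; halvings through the duplication quartic, a monic
quartic with algebraic coefficients, `isIntegral_trans`), lie on the curve, satisfy `x m = e₁`,
`x aa = x_P`, the reflection `x (n−k) = x k`, `y (n−k) = −y k`, strict decrease on `1..m`,
negativity of `y` on `1..m−1`, the chord law in regular form with `P₁ = (x 1, y 1)`, and the
interval behaviour of the lower-branch translation `τ` (`= X(u+δ)`) and of the upper-branch
translation `τ⁺` (`= X(u−δ)`), plus integrability of `1/√f` on `(e₁, ∞)`. Here `n = 8N′`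
(`a/N = a′/N′` in lowest terms).
[cite: Lawden1989, §6.8, §6.11] [cite: SilvermanAEC2009, III.2.3] -/
theorem stub_gridData :
    ∀ (g₂ g₃ e₁ xP : ℝ) (N a : ℕ) (f : ℝ → ℝ),
    (∀ x, f x = 4 * x ^ 3 - g₂ * x - g₃) → g₂ ^ 3 - 27 * g₃ ^ 2 ≠ 0 → f e₁ = 0 → 0 < e₁ →
    (∀ x, e₁ < x → 0 < f x) → e₁ < xP → 3 ≤ N → 0 < a → 2 * a < N →
    (N : ℝ) * (∫ x in Set.Ioi xP, (Real.sqrt (f x))⁻¹) = a * (2 * ∫ x in Set.Ioi e₁, (Real.sqrt (f x))⁻¹) →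
    IsAlgebraic ℚ g₂ → IsAlgebraic ℚ g₃ → IsAlgebraic ℚ e₁ → IsAlgebraic ℚ xP →
    ∃ (n m aa : ℕ) (x y : ℕ → ℝ), 12 ≤ n ∧ n = 2 * m ∧ 1 ≤ aa ∧ aa < m ∧
      2 * N * (m - aa) = n * (N - 2 * a) ∧
      x m = e₁ ∧ y m = 0 ∧ x aa = xP ∧
      (∀ k, 1 ≤ k → k < n → IsAlgebraic ℚ (x k) ∧ IsAlgebraic ℚ (y k) ∧ y k ^ 2 = f (x k) ∧ e₁ ≤ x k) ∧
      (∀ k, 1 ≤ k → k < m → e₁ < x k ∧ y k < 0) ∧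
      (∀ k, 1 ≤ k → k < n → x (n - k) = x k ∧ y (n - k) = -y k) ∧
      (∀ k, 1 ≤ k → k < m → x (k + 1) < x k) ∧
      (∀ k, 1 ≤ k → k + 1 < n → y k + y 1 ≠ 0 ∧
        x (k + 1) = ((4 * x k ^ 2 + 4 * x k * x 1 + 4 * x 1 ^ 2 - g₂) / (y k + y 1)) ^ 2 / 4 - x k - x 1 ∧
        y (k + 1) = -(y k + (4 * x k ^ 2 + 4 * x k * x 1 + 4 * x 1 ^ 2 - g₂) / (y k + y 1) * (x (k + 1) - x k))) ∧
      MeasureTheory.IntegrableOn (fun t => (Real.sqrt (f t))⁻¹) (Set.Ioi e₁) ∧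
      (∀ τ : ℝ → ℝ,
        τ = (fun t => ((4 * t ^ 2 + 4 * t * x 1 + 4 * x 1 ^ 2 - g₂) / (-Real.sqrt (f t) + y 1)) ^ 2 / 4 - t - x 1) →
        (∀ t, e₁ < t → -Real.sqrt (f t) + y 1 ≠ 0) ∧ ContinuousOn τ (Set.Ici e₁) ∧
        StrictMonoOn τ (Set.Ici (x 1)) ∧ τ '' Set.Ioi (x 1) = Set.Ioo (x 2) (x 1) ∧
        (∀ k, 1 ≤ k → k + 2 ≤ m → StrictMonoOn τ (Set.Icc (x (k + 1)) (x k)) ∧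
          τ '' Set.Ioo (x (k + 1)) (x k) = Set.Ioo (x (k + 2)) (x (k + 1)) ∧
          τ (x k) = x (k + 1) ∧ τ (x (k + 1)) = x (k + 2)) ∧
        StrictAntiOn τ (Set.Icc e₁ (x (m - 1))) ∧ τ '' Set.Ioo e₁ (x (m - 1)) = Set.Ioo e₁ (x (m - 1)) ∧
        τ e₁ = x (m - 1) ∧ τ (x (m - 1)) = e₁) ∧
      (∀ τ' : ℝ → ℝ,
        τ' = (fun t => ((4 * t ^ 2 + 4 * t * x 1 + 4 * x 1 ^ 2 - g₂) / (Real.sqrt (f t) + y 1)) ^ 2 / 4 - t - x 1) →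
        (∀ t, e₁ ≤ t → t < x 1 → Real.sqrt (f t) + y 1 ≠ 0) ∧ ContinuousOn τ' (Set.Ico e₁ (x 1)) ∧
        StrictMonoOn τ' (Set.Ico (x 2) (x 1)) ∧ τ' '' Set.Ioo (x 2) (x 1) = Set.Ioi (x 1) ∧ τ' (x 2) = x 1 ∧
        (∀ k, 2 ≤ k → k + 1 ≤ m → StrictMonoOn τ' (Set.Icc (x (k + 1)) (x k)) ∧
          τ' '' Set.Ioo (x (k + 1)) (x k) = Set.Ioo (x k) (x (k - 1)) ∧
          τ' (x (k + 1)) = x k ∧ τ' (x k) = x (k - 1))) := by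
  intro g₂ g₃ e₁ xP N a f hf hdisc he he0 hpos hxP hN ha h2a htor hg₂ hg₃ _he₁ hxPalg
  obtain ⟨ω, X, Y, hD⟩ := stub_realDictionary g₂ g₃ e₁ f hf hdisc he hpos
  obtain ⟨hω, hωint, -, -, -, -, hXh, -, -, hYsq, -, -, hsurj, hint, -, -, -, -⟩ := id hD
  -- `a/N` in lowest terms
  obtain ⟨g, a', N', hg, rfl, rfl, hcop, ha', h2a'⟩ := gridData_torsion_arith ha h2a
  have hN'3 : 3 ≤ N' := by omega
  have hgr : (0 : ℝ) < g := by exact_mod_cast hg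
  have hN'r : (0 : ℝ) < N' := by exact_mod_cast (by omega : 0 < N')
  -- the parameter of `P`: `u_P = a′ω/N′`
  obtain ⟨uP, huP, hXuP⟩ := hsurj xP hxP
  have huPeq : uP = (a' : ℝ) * (ω / N') := by
    have h1 := hint uP ⟨huP.1, huP.2.le⟩
    rw [hXuP] at h1
    rw [h1, ← hωint] at htor
    push_cast at htor
    field_simp
    nlinarith [htor]
  have hYuP : IsAlgebraic ℚ (Y uP) := by
    refine IsAlgebraic.of_pow two_pos ?_
    rw [hYsq uP ⟨huP.1, by linarith [huP.2]⟩, hXuP, hf]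
    rw [← mem_algebraicClosure_iff] at hg₂ hg₃ hxPalg ⊢
    apply_rules only [hg₂, hg₃, hxPalg, add_mem, sub_mem, neg_mem, pow_mem, div_mem, inv_mem,
      mul_mem, ofNat_mem, one_mem, zero_mem]
  -- the grid
  set δ : ℝ := ω / (8 * N') with hδ
  have hnδ : ((8 * N' : ℕ) : ℝ) * δ = ω := by
    rw [hδ]
    push_cast
    field_simp
  have hnm : 8 * N' = 2 * (4 * N') := by ring
  have hm2 : 2 ≤ 4 * N' := by omega
  obtain ⟨x, hx⟩ : ∃ x : ℕ → ℝ, ∀ k, x k = X (k * δ) := ⟨_, fun _ => rfl⟩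
  obtain ⟨y, hy⟩ : ∃ y : ℕ → ℝ, ∀ k, y k = Y (k * δ) := ⟨_, fun _ => rfl⟩
  -- algebraicity of `P₁`, then of the whole grid
  have hXP : IsAlgebraic ℚ (X ((a' : ℝ) * (ω / N'))) := by rw [← huPeq, hXuP]; exact hxPalg
  have hYP : IsAlgebraic ℚ (Y ((a' : ℝ) * (ω / N'))) := by rw [← huPeq]; exact hYuP
  have h1 : IsAlgebraic ℚ (x 1) ∧ IsAlgebraic ℚ (y 1) := by
    rw [hx, hy, Nat.cast_one, one_mul, hδ]
    exact gridData_alg_delta hf hD hg₂ hg₃ ha' h2a' hcop hXP hYP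
  obtain ⟨hxm, hym, hcurve, hsign, hrefl, hdec⟩ := gridData_grid_basic hD hnm hm2 hnδ hx hy
  have hchord := gridData_grid_chord hf hD hnm hm2 hnδ hx hy he he0 hpos
  have halg := gridData_grid_alg hg₂ h1.1 h1.2 hchord
  refine ⟨8 * N', 4 * N', 8 * a', x, y, by omega, hnm, by omega, by omega, ?_, hxm, hym, ?_, ?_,
    hsign, hrefl, hdec, hchord, ?_, gridData_tau_props hf hD hnm hm2 hnδ hx hy,
    gridData_tau'_props hf hD hnm hm2 hnδ hx hy he he0 hpos⟩
  · -- `2N(m − aa) = n(N − 2a)`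
    have le1 : 8 * a' ≤ 4 * N' := by omega
    have le2 : 2 * (a' * g) ≤ N' * g := by nlinarith
    zify [le1, le2]
    ring
  · -- `x aa = x_P`
    rw [hx, ← hXuP, huPeq, hδ]
    congr 1
    push_cast
    field_simp
  · -- algebraicity, on-curve, `e₁ ≤ x k`
    intro k hk hkn
    exact ⟨(halg k hk hkn).1, (halg k hk hkn).2, hcurve k hk hkn⟩
  · -- integrability of `1/√f` on `(e₁, ∞)`
    refine MeasureTheory.Integrable.of_integral_ne_zero fun h0 => ?_
    rw [h0, mul_zero] at hωint
    exact hω.ne' hωint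

end Summit.KontsevichZagierPeriods.KontsevichZagierPeriods.Cruxes.NeronTorsionSector.Translation
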